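import Mathlib.RingTheory.LocalRing.Module
import Mathlib.LinearAlgebra.TensorProduct.Pi
import Mathlib.Algebra.Module.Projective
import HarnessLib

/-!
# Residually independent elements of a projective module over a local ring split off

Topic: `Literature/AlgebraicGeometry/Resolution` (linear algebra over a local ring, used for the
Jacobian criterion over the prime field in `RegularFormallySmoothPrimeField.lean`, where the
module of differentials is projective of infinite rank). Let `(A, 𝔪, κ)` be a local ring and
`m_1, …, m_c` elements of a projective `A`-module `F` whose images in `F/𝔪F` are `κ`-linearly
independent, rendered as `Σ aᵢ mᵢ ∈ 𝔪F ⇒ aᵢ ∈ 𝔪 (∀ i)`. Then `A^c → F`, `eᵢ ↦ mᵢ`, is split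
injective: there is `φ : F → A^c` with `φ(mᵢ) = eᵢ`. Everything is PROVED:

* `piScalarRight_one_tmul_apply` — bookkeeping: in `κ ⊗_A A^ι ≃ κ^ι`, `1 ⊗ f ↦ (f̄ⱼ)ⱼ`;
* `exists_linearMap_pi_apply_eq_single` — the finite free case `F = A^J` (Mathlib's
  `IsLocalRing.split_injective_iff_lTensor_residueField_injective`: a map of finite free
  modules splits iff it is injective after `κ ⊗ -`);
* `exists_linearMap_apply_eq_single` — the projective case: `F` is a direct summand of the free
  module `A^{(F)}` (`Module.projective_def'`), the finitely many `s(mᵢ)` involve a finite set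
  `J` of coordinates, and restricting to `A^J` keeps them residually independent.

## Sources

* The Stacks Project, Tag 00NZ ff. (finite projective modules over local rings are free; the
  splitting criterion modulo `𝔪`) — the finite case; the reduction of the infinite-rank
  projective case to it is folklore. [StacksProject]
-/

noncomputable section

namespace Literature.AlgebraicGeometry.Resolution

universe u v

open IsLocalRing Module TensorProduct

/-! ## Splitting off residually independent elements of a projective module -/

section Split

variable {A : Type u} [CommRing A] [IsLocalRing A]

/-- In `κ ⊗_A A^ι ≃ κ^ι` (`TensorProduct.piScalarRight`), the element `1 ⊗ f` has coordinates the
residues of the `f j`. [folklore] -/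
theorem piScalarRight_one_tmul_apply {ι : Type*} [Fintype ι] [DecidableEq ι] (f : ι → A)
    (j : ι) :
    TensorProduct.piScalarRight A (ResidueField A) (ResidueField A) ι
      ((1 : ResidueField A) ⊗ₜ[A] f) j = residue A (f j) := by
  rw [piScalarRight_apply, piScalarRightHom_tmul]
  change f j • (1 : ResidueField A) = residue A (f j)
  rw [Algebra.smul_def, mul_one]
  rfl

/-- **Residually independent rows of a finite free module split off** (local ring `(A, 𝔪, κ)`):
if `v_1, …, v_c ∈ A^J` satisfy `Σ aᵢ vᵢ ∈ 𝔪 A^J ⇒ aᵢ ∈ 𝔪` (their images in `κ^J` are linearly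
independent), there is an `A`-linear `ψ : A^J → A^c` with `ψ(vᵢ) = eᵢ` (Mathlib's
`IsLocalRing.split_injective_iff_lTensor_residueField_injective` for `A^c → A^J`, `eᵢ ↦ vᵢ`).
[folklore] -/
theorem exists_linearMap_pi_apply_eq_single {c : ℕ} {J : Type*} [Fintype J] [DecidableEq J]
    (v : Fin c → (J → A))
    (hv : ∀ a : Fin c → A, (∀ j, (∑ i, a i • v i) j ∈ maximalIdeal A) →
      ∀ i, a i ∈ maximalIdeal A) :
    ∃ ψ : (J → A) →ₗ[A] (Fin c → A), ∀ i, ψ (v i) = Pi.single i 1 := by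
  classical
  set l₀ : (Fin c → A) →ₗ[A] (J → A) := Fintype.linearCombination A v with hl₀
  have hl₀single : ∀ i, l₀ (Pi.single i 1) = v i := fun i => by
    rw [hl₀, Fintype.linearCombination_apply_single, one_smul]
  suffices h : ∃ ψ : (J → A) →ₗ[A] (Fin c → A), ψ ∘ₗ l₀ = LinearMap.id by
    obtain ⟨ψ, hψ⟩ := h
    exact ⟨ψ, fun i => by rw [← hl₀single, ← LinearMap.comp_apply, hψ, LinearMap.id_apply]⟩
  rw [IsLocalRing.split_injective_iff_lTensor_residueField_injective]
  set κ := ResidueField A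
  have htmul : ∀ z : κ ⊗[A] (Fin c → A), ∃ a : Fin c → A, z = (1 : κ) ⊗ₜ[A] a := by
    intro z
    induction z using TensorProduct.induction_on with
    | zero => exact ⟨0, by rw [tmul_zero]⟩
    | tmul x a =>
      obtain ⟨r, rfl⟩ := residue_surjective x
      refine ⟨r • a, ?_⟩
      rw [tmul_smul, smul_tmul', Algebra.smul_def, mul_one]
      rfl
    | add z₁ z₂ h₁ h₂ =>
      obtain ⟨a₁, rfl⟩ := h₁
      obtain ⟨a₂, rfl⟩ := h₂
      exact ⟨a₁ + a₂, by rw [tmul_add]⟩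
  rw [injective_iff_map_eq_zero]
  intro z hz
  obtain ⟨a, rfl⟩ := htmul z
  rw [LinearMap.lTensor_tmul] at hz
  have hcoord : ∀ j, (l₀ a) j ∈ maximalIdeal A := by
    intro j
    have h1 := congrArg (fun w => TensorProduct.piScalarRight A κ κ J w j) hz
    simp only [map_zero, Pi.zero_apply] at h1
    rw [piScalarRight_one_tmul_apply] at h1
    exact (residue_eq_zero_iff _).mp h1
  have hsum : ∀ j, (∑ i, a i • v i) j ∈ maximalIdeal A := by
    intro j
    have : l₀ a = ∑ i, a i • v i := by
      rw [hl₀, Fintype.linearCombination_apply]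
    rw [← this]
    exact hcoord j
  have ha : ∀ i, a i ∈ maximalIdeal A := hv a hsum
  apply (TensorProduct.piScalarRight A κ κ (Fin c)).injective
  rw [map_zero]
  ext i
  rw [piScalarRight_one_tmul_apply, Pi.zero_apply]
  exact (residue_eq_zero_iff _).mpr (ha i)

/-- **Residually independent elements of a projective module split off.** Let `(A, 𝔪, κ)` be a
local ring, `F` a projective `A`-module (of any rank) and `m_1, …, m_c ∈ F` with
`Σ aᵢ mᵢ ∈ 𝔪F ⇒ aᵢ ∈ 𝔪` for all `a ∈ A^c` (the images of the `mᵢ` in `F/𝔪F` are `κ`-linearly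
independent). Then there is an `A`-linear map `φ : F → A^c` with `φ(mᵢ) = eᵢ`; in particular
`A^c → F`, `eᵢ ↦ mᵢ`, is split injective. (Write `F` as a direct summand of a free module
`A^{(F)}`, `s : F → A^{(F)}`, `Σ ∘ s = id`; the finitely many `s(mᵢ)` involve finitely many
coordinates `J`, and the restriction `A^{(F)} → A^J` keeps them residually independent, so the
finite free case applies.) [folklore] -/
theorem exists_linearMap_apply_eq_single {F : Type v} [AddCommGroup F] [Module A F]
    [Module.Projective A F] {c : ℕ} (m : Fin c → F)
    (hm : ∀ a : Fin c → A, (∑ i, a i • m i) ∈ (maximalIdeal A) • (⊤ : Submodule A F) →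
      ∀ i, a i ∈ maximalIdeal A) :
    ∃ φ : F →ₗ[A] (Fin c → A), ∀ i, φ (m i) = Pi.single i 1 := by
  classical
  obtain ⟨s, hs⟩ := Module.projective_def'.mp ‹Module.Projective A F›
  have hs' : ∀ x, Finsupp.linearCombination A id (s x) = x := fun x => by
    rw [← LinearMap.comp_apply, hs, LinearMap.id_apply]
  -- the finitely many coordinates involved
  let n : Fin c → (F →₀ A) := fun i => s (m i)
  let J₀ : Finset F := Finset.univ.biUnion fun i => (n i).support
  let J : Type v := (J₀ : Set F)
  -- restriction to the coordinates in `J₀`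
  let r : (F →₀ A) →ₗ[A] (J → A) := LinearMap.pi fun j : J => Finsupp.lapply (j : F)
  let v : Fin c → (J → A) := fun i => r (n i)
  -- the hypothesis of the finite free case
  have hv : ∀ a : Fin c → A, (∀ j, (∑ i, a i • v i) j ∈ maximalIdeal A) →
      ∀ i, a i ∈ maximalIdeal A := by
    intro a ha
    apply hm a
    set y : F →₀ A := ∑ i, a i • n i with hy
    have hyf : ∀ f : F, y f = ∑ i, a i * (n i) f := fun f => by
      rw [hy, Finsupp.finsetSum_apply]
      exact Finset.sum_congr rfl fun i _ => by rw [Finsupp.smul_apply, smul_eq_mul]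
    -- all coordinates of `y` lie in `𝔪`
    have hyJ : ∀ f : F, y f ∈ maximalIdeal A := by
      intro f
      by_cases hf : f ∈ J₀
      · have h1 := ha ⟨f, hf⟩
        have h2 : (∑ i, a i • v i) (⟨f, hf⟩ : J) = y f := by
          rw [hyf, Finset.sum_apply]
          exact Finset.sum_congr rfl fun i _ => by rw [Pi.smul_apply, smul_eq_mul]; rfl
        rwa [h2] at h1
      · have h0 : y f = 0 := by
          rw [hyf]
          refine Finset.sum_eq_zero fun i _ => ?_
          have hn : (n i) f = 0 := by
            rw [← Finsupp.notMem_support_iff]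
            exact fun hmem => hf (Finset.mem_biUnion.mpr ⟨i, Finset.mem_univ _, hmem⟩)
          rw [hn, mul_zero]
        rw [h0]
        exact zero_mem _
    -- hence `y ∈ 𝔪 • ⊤` and `∑ aᵢ mᵢ = Σ y ∈ 𝔪 • ⊤`
    have hymem : y ∈ (maximalIdeal A) • (⊤ : Submodule A (F →₀ A)) := by
      rw [← Finsupp.sum_single y]
      refine Submodule.sum_mem _ fun f _ => ?_
      rw [← Finsupp.smul_single_one]
      exact Submodule.smul_mem_smul (hyJ f) Submodule.mem_top
    have hsum : ∑ i, a i • m i = Finsupp.linearCombination A id y := by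
      rw [hy, map_sum]
      exact Finset.sum_congr rfl fun i _ => by rw [map_smul, hs']
    rw [hsum]
    have hmap := Submodule.mem_map_of_mem (f := Finsupp.linearCombination A (id : F → F)) hymem
    rw [Submodule.map_smul''] at hmap
    exact Submodule.smul_mono le_rfl le_top hmap
  obtain ⟨ψ, hψ⟩ := exists_linearMap_pi_apply_eq_single v hv
  refine ⟨ψ ∘ₗ r ∘ₗ s, fun i => ?_⟩
  rw [LinearMap.comp_apply, LinearMap.comp_apply]
  exact hψ i

end Split

end Literature.AlgebraicGeometry.Resolution

end
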